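import Summits.Ventures.HodgeRepro2.Defs

/-!
# T4Anisotropic — the surface's hermitian space is anisotropic in the Compact Case (T4-B)

Seat p3 of the blind cell `pub-hodge-repro2` (Tier 4, README §6).  Imports seat p1's `Defs.lean`
(Shimura 1979 data `Thm81Data`).

The T4-B row «the Picard surface `Sh(G(ι₁), h_{V,τ₁})_K(ℂ)` is COMPACT» (PLAN §6.3(c)) rests on
the printed input that a unitary group of an ANISOTROPIC hermitian space has compact arithmetic
quotients (Borel–Harish-Chandra; Dimitrov–Ramakrishnan 2015 p. 1: «an anisotropic hermitian form
on `M³` of signature `(2,1)` at one infinite place and `(3,0)` at the others»; the same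
anisotropy is the printed hypothesis of Gan–Qiu–Takeda Theorem 18, TIER3 §6 item 21, corrected in
v1.11 from «compact at infinity»).  The elementary half — the space IS anisotropic — is proved
here in p1's vocabulary: a Shimura datum `D : Thm81Data K r` has `−i T^{τ′}` positive definite at
every member `τ′ ≠ τ₁` of its CM type, and when `[K : ℚ] > 2` (the Compact Case, `d > 1`) such a
`τ′` exists, so the skew-hermitian form `B(x, y) = x · T · ᵗȳ` satisfies `B(x, x) ≠ 0` for every
`x ≠ 0` (`Thm81Data.anisotropic`): applying `τ′` to `B(x, x)` gives `i · (v̄ᴴ (−i T^{τ′}) v̄)` with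
`v = τ′(x) ≠ 0`, a non-zero number by positive definiteness.  In the non-compact case `d = 1`
(`K` imaginary quadratic) no such `τ′` exists and the argument — like the compactness — fails.

Axioms: propext, Classical.choice, Quot.sound.
-/

namespace Summit.Ventures.HodgeRepro2.T4Anisotropic

open Matrix NumberField Module
open Summit.Ventures.HodgeRepro2
open scoped ComplexOrder

variable {K : Type*} [Field K] [NumberField K] [IsCMField K]

/-- The skew-hermitian form of a matrix `T` in p1's row convention: `B(x, y) = x · T · ᵗȳ`
(the unitary group `unitaryGroupOf K T = {α | α T ᵗᾱ = T}` preserves it). -/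
noncomputable def skewForm {m : ℕ} (T : Matrix (Fin m) (Fin m) K) (x y : Fin m → K) : K :=
  x ⬝ᵥ (T *ᵥ star y)

/-- An embedding commutes with the CM conjugation (`star` on `K` is `complexConj`, on `ℂ` it is
complex conjugation). -/
theorem embedding_star (τ : K →+* ℂ) (x : K) : τ (star x) = star (τ x) := by
  change τ (IsCMField.complexConj K x) = _
  rw [IsCMField.complexEmbedding_complexConj]
  rfl

/-- The form transported along an embedding: `τ(B(x, y)) = τ(x) · T^τ · ᵗ(conj τ(y))`. -/
theorem map_skewForm {m : ℕ} (T : Matrix (Fin m) (Fin m) K) (τ : K →+* ℂ) (x y : Fin m → K) :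
    τ (skewForm T x y) = (τ ∘ x) ⬝ᵥ ((T.map τ) *ᵥ star (τ ∘ y)) := by
  unfold skewForm
  rw [RingHom.map_dotProduct]
  congr 1
  have hstar : (τ ∘ star y) = star (τ ∘ y) := by
    funext j
    simp [embedding_star]
  funext i
  rw [Function.comp_apply, RingHom.map_mulVec, hstar]

omit [IsCMField K] in
/-- In the Compact Case a CM type has a member other than any given embedding: the embeddings
are `[K : ℚ] > 2` in number, a CM type contains exactly one of each conjugate pair, so it cannot
be `{τ}`. -/
theorem exists_mem_ne_of_isCMType {Φ : Set (K →+* ℂ)} (hΦ : IsCMType K Φ) (τ : K →+* ℂ)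
    (h : 2 < finrank ℚ K) : ∃ τ' ∈ Φ, τ' ≠ τ := by
  classical
  by_contra hcon
  push Not at hcon
  have hsub : (Finset.univ : Finset (K →+* ℂ)) ⊆ {τ, ComplexEmbedding.conjugate τ} := by
    intro φ _
    rcases hΦ φ with ⟨hφ, _⟩ | ⟨hφc, _⟩
    · have := hcon φ hφ
      subst this
      simp
    · have := hcon _ hφc
      have hφ' : φ = ComplexEmbedding.conjugate τ := by
        rw [← this]
        exact (ComplexEmbedding.involutive_conjugate K φ).symm
      rw [hφ']
      simp
  have hcard := Finset.card_le_card hsub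
  rw [Finset.card_univ, Embeddings.card K ℂ] at hcard
  have h2 : ({τ, ComplexEmbedding.conjugate τ} : Finset (K →+* ℂ)).card ≤ 2 :=
    Finset.card_le_two
  omega

/-- ANISOTROPY IN THE COMPACT CASE: for a Shimura datum `D` (positive definite `−i T^{τ′}` at
every member `τ′ ≠ τ₁` of the CM type) over a CM field with `[K : ℚ] > 2`, the skew-hermitian
form is anisotropic: `B(x, x) ≠ 0` for `x ≠ 0`. -/
theorem anisotropic_of_thm81Data {r : ℕ} (D : Thm81Data K r) (h : 2 < finrank ℚ K)
    (x : Fin (r + 1) → K) (hx : x ≠ 0) : skewForm D.T x x ≠ 0 := by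
  obtain ⟨τ', hτ'Φ, hτ'⟩ := exists_mem_ne_of_isCMType D.cmtype D.τ h
  have hpos := D.definite τ' hτ'Φ hτ'
  set v : Fin (r + 1) → ℂ := τ' ∘ x with hv
  have hv0 : v ≠ 0 := by
    intro hv0
    apply hx
    funext i
    have := congrFun hv0 i
    simp only [hv, Function.comp_apply, Pi.zero_apply] at this
    exact (map_eq_zero τ').mp this
  have hw0 : star v ≠ 0 := by
    intro hw
    apply hv0
    have := congrArg star hw
    rwa [star_star, star_zero] at this
  have hlt := hpos.dotProduct_mulVec_pos hw0
  rw [star_star, smul_mulVec, dotProduct_smul] at hlt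
  intro hB
  have hmap := map_skewForm D.T τ' x x
  rw [hB, map_zero] at hmap
  have hmap' : v ⬝ᵥ (D.T.map τ' *ᵥ star v) = 0 := by
    rw [hv]
    exact hmap.symm
  rw [hmap', smul_zero] at hlt
  exact lt_irrefl _ hlt

/-- The same, in p1's `IsCompactCase` vocabulary (Shimura's remark after Theorem 8.1; Liu's
Compact Case `d > 1`). -/
theorem anisotropic_of_isCompactCase {r : ℕ} (D : Thm81Data K r) (h : IsCompactCase K)
    (x : Fin (r + 1) → K) (hx : x ≠ 0) : skewForm D.T x x ≠ 0 :=
  anisotropic_of_thm81Data D h x hx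

end Summit.Ventures.HodgeRepro2.T4Anisotropic
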